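import Summits.ResolutionOfSingularities.ResolutionOfSingularities.Theorems.HomologicalConductorNoZenoRFirstKindClosedImage
import Summits.ResolutionOfSingularities.ResolutionOfSingularities.Theorems.HomologicalConductorNoZenoBaseIdealPNonemptyNegDef
import HarnessLib

/-!
# Crux `NoZenoR` (stmt-ResolutionOfSingularities-19943) — the converse dictionary and the COUNT-DROP ingredient of the
# localisation step: a curve contracted by the domination `σ : X → Bl_𝔪 Spec S` has `(Z·E) = 0`, hence SOME integral
# exceptional curve is NOT contracted (it dominates a component of the exceptional fibre of the quadratic transform)

Route `ResolutionOfSingularities/HomologicalConductor` (cell decomp-res, hand leafhand-res-homologicalconduct-24 g0).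
OURS: AI-written proof over tree theorems, weaker than expert review; nothing here is a statement of the manuscript
under review (Hironaka 2017).  SUPPORT level, counted 0.  Def-free, fact-free (du Val negative definiteness (14.1) and
(13.1) are tree theorems).

* `mem_nonvanishing_of_stalkIdeal_baseIdeal_eq_span` — dictionary, converse of
  `stalkIdeal_baseIdeal_eq_span_of_mem_nonvanishing`: `𝔞·𝒪_{X,x} = (c)` ⇒ `x ∈ (−Z).nonvanishing c`;
* `excCurveDegree_baseIdeal_eq_zero_of_isClosed_apply` — `S` rational non-regular, `π : X → Spec S` a
  desingularization, `b : V → Spec S` a blowing up of `𝔪`, `σ : X → V` with `σ ≫ b = π`; if `σ η` is a CLOSED point then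
  `(Z·E_η) = 0` for the cycle `Z` of `𝔪𝒪_X` (`𝔪𝒪_{V,σ η}` is principal, generated by some `c ∈ 𝔪` — Nakayama — so `c`
  generates `𝔪𝒪_X` along `cl{η}` and `−Z + div(c)` avoids `cl{η}`);
* **`exists_mem_excCurvePoints_not_isClosed_apply`** — hence some `η′ ∈ excCurvePoints π` has `σ η′` NOT closed: by
  du Val (tree `ExcCount.baseIdealDivisor_antinef_and_exists_neg_negDef`) some curve has `(Z·E_{η′}) < 0`.

With `…FirstKindClosedImage` (first-kind curves ARE contracted to closed points) this is the count drop of the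
localisation step `hstep` of `…MinimalNoFirstKindOfStep`: the curves over `σ η` are a PROPER subset of `excCurvePoints π`.
No crux or summit statement is proved here.
-/

noncomputable section

-- single-problem summit: the doubled namespace component `ResolutionOfSingularities` is forced
set_option linter.dupNamespace false

open CategoryTheory CategoryTheory.Limits AlgebraicGeometry TopologicalSpace IsLocalRing
open Literature.AlgebraicGeometry Literature.AlgebraicGeometry.Resolution Literature.AlgebraicGeometry.Motives
open Literature.AlgebraicGeometry.Motives.RatFn
open Summit.ResolutionOfSingularities.ResolutionOfSingularities.Theorems.NoZeno.SandwichCluster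
  (toFunctionField_germ_appTop)

namespace Summit.ResolutionOfSingularities.ResolutionOfSingularities.Theorems.NoZeno.FirstKind

/-! ## §1 Dictionary, converse direction -/

section Dictionary

variable {T : Type} [CommRing T] {X : Scheme.{0}} [IsIntegral X] (π : X ⟶ Spec (.of T)) {𝔞 : Ideal T}
  (hJ : IsEffectiveCartier (Scheme.IdealSheafData.ofIdealTop (𝔞.map (Morphisms.algebraMapΓ π))))

include hJ in
/-- **`𝔞·𝒪_{X,x} = (c)` ⇒ `x ∈ (−Z).nonvanishing c`** (`Z` the Cartier divisor of `𝔞𝒪_X`).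
[cite: GortzWedhorn2020, Remark 11.27 (p. 378)] -/
theorem mem_nonvanishing_of_stalkIdeal_baseIdeal_eq_span {c : T} {x : X}
    (hx : stalkIdeal (Scheme.IdealSheafData.ofIdealTop (𝔞.map (Morphisms.algebraMapΓ π))) x =
      Ideal.span {ExcCount.toStalk π x c}) :
    x ∈ (-CartierDivisor.ofIsEffectiveCartier _ hJ).nonvanishing (baseToFunctionField π c) := by
  have hxU : x ∈ (CartierDivisor.cartierChart _ hJ x : X.Opens) := CartierDivisor.mem_cartierChart _ hJ x
  have h2 : stalkIdeal (Scheme.IdealSheafData.ofIdealTop (𝔞.map (Morphisms.algebraMapΓ π))) x =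
      Ideal.span {(X.presheaf.germ _ x hxU).hom (CartierDivisor.cartierGen _ hJ x)} := by
    rw [stalkIdeal_eq_map_germ _ (CartierDivisor.cartierChart _ hJ x) hxU,
      CartierDivisor.ideal_cartierChart, Ideal.map_span, Set.image_singleton]
  have hgerm0 : (X.presheaf.germ _ x hxU).hom (CartierDivisor.cartierGen _ hJ x) ≠ 0 := fun h0 =>
    CartierDivisor.cartierGen_ne_zero _ hJ x
      (germ_injective_of_isIntegral (X := X) x hxU (h0.trans (map_zero _).symm))
  have hgen : Ideal.span {ExcCount.toStalk π x c} =
      Ideal.span {(X.presheaf.germ _ x hxU).hom (CartierDivisor.cartierGen _ hJ x)} := hx.symm.trans h2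
  obtain ⟨u, hu⟩ := Ideal.span_singleton_eq_span_singleton.mp hgen.symm
  have hcK : baseToFunctionField π c = toFunctionField x (ExcCount.toStalk π x c) :=
    (toFunctionField_germ_appTop π x c).symm
  have hgK : (CartierDivisor.ofIsEffectiveCartier _ hJ).f x =
      toFunctionField x ((X.presheaf.germ _ x hxU).hom (CartierDivisor.cartierGen _ hJ x)) := by
    rw [CartierDivisor.ofIsEffectiveCartier_f, ← toFunctionField_germ_eq_secFn hxU hxU]
  have hg0 : toFunctionField x ((X.presheaf.germ _ x hxU).hom (CartierDivisor.cartierGen _ hJ x)) ≠ 0 := by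
    rw [← hgK]; exact (CartierDivisor.ofIsEffectiveCartier _ hJ).f_ne_zero x
  have hxU' : x ∈ (-CartierDivisor.ofIsEffectiveCartier _ hJ).U x := hxU
  rw [CartierDivisor.mem_nonvanishing_iff hxU', CartierDivisor.neg_f, hcK, hgK, ← hu, map_mul, ← mul_assoc,
    inv_mul_cancel₀ hg0, one_mul]
  exact ⟨u, rfl⟩

end Dictionary

/-! ## §2 Curves contracted by `σ` have `(Z·E) = 0`; some curve is not contracted -/

section Main

variable {S : Type} [CommRing S] [IsNoetherianRing S] [IsLocalRing S] [IsDomain S] [IsIntegrallyClosed S]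
  {X : Scheme.{0}} [IsIntegral X] [IsLocallyNoetherian X] (π : X ⟶ Spec (.of S))

omit [IsNoetherianRing S] [IsIntegrallyClosed S] in
/-- **A curve contracted by the domination has `(Z·E) = 0`.**  `S` rational non-regular, `π : X → Spec S` a
desingularization, `b : V → Spec S` a blowing up of `𝔪`, `σ : X → V` with `σ ≫ b = π`, `η ∈ excCurvePoints π` with
`σ η` a CLOSED point of `V`, `Z` the cycle of `𝔪𝒪_X`: then `(Z·E_η) = 0`.  (`𝔪𝒪_{V,σ η}` is invertible, generated by
some `c ∈ 𝔪` (Nakayama); pulling back, `c` generates `𝔪𝒪_X` at every point of `cl{η} ⊆ σ⁻¹(σ η)`, so the effective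
divisor `−Z + div(c)` avoids `cl{η}` and has degree `0 = −(Z·E_η)`.)
[cite: Lipman1969, Section 12, Remark 2 c) (p. 221); Section 15 b) (p. 227)] -/
theorem excCurveDegree_baseIdeal_eq_zero_of_isClosed_apply
    (hπ : IsResolution π) {V : Scheme.{0}} {b : V ⟶ Spec (.of S)}
    (hb : IsBlowup b (affineBlowup.idealSheaf (maximalIdeal S))) (σ : X ⟶ V) (hσ : σ ≫ b = π)
    {η : X} (hη : η ∈ excCurvePoints π) (hclosed : IsClosed ({σ.base η} : Set V))
    (hJ : IsEffectiveCartier (Scheme.IdealSheafData.ofIdealTop ((maximalIdeal S).map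
      (Morphisms.algebraMapΓ π)))) :
    excCurveDegree π (CartierDivisor.ofIsEffectiveCartier _ hJ) η = 0 := by
  haveI : IsProper π := hπ.isProper
  haveI : IsDominant π := hπ.isBirational.isDominant
  set K := (affineBlowup.idealSheaf (maximalIdeal S)).comap b with hKdef
  have hKσ : K.comap σ = Scheme.IdealSheafData.ofIdealTop ((maximalIdeal S).map (Morphisms.algebraMapΓ π)) := by
    rw [hKdef, ← Scheme.IdealSheafData.comap_comp, hσ, ExcCount.comap_affineBlowupIdealSheaf_eq_baseIdeal]
  set v := σ.base η with hvdef
  -- `𝔪𝒪_{V,v} = (t) = (c_v)` for some `c ∈ 𝔪`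
  obtain ⟨t, ht, hKt⟩ := hb.isEffectiveCartier.exists_stalkIdeal_eq_span v
  have ht0 : t ≠ 0 := nonZeroDivisors.ne_zero ht
  have hKv : stalkIdeal K v = (maximalIdeal S).map (ExcCount.toStalk b v) := by
    rw [hKdef, ExcCount.stalkIdeal_comap_affineBlowupIdealSheaf]
  have hspan : Ideal.span ((ExcCount.toStalk b v) '' (maximalIdeal S : Set S)) = Ideal.span {t} := by
    rw [← hKt, hKv, Ideal.map]
  obtain ⟨_, ⟨c, hc, rfl⟩, hgen⟩ := exists_mem_span_singleton_eq_of_span_eq ht0 hspan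
  -- for every point `w = v`: `𝔪𝒪_{V,w} = (c_w)`
  have hP : ∀ w : V, w = v → stalkIdeal K w = Ideal.span {ExcCount.toStalk b w c} := by
    rintro w rfl
    rw [hKt, ← hgen]
  -- along `cl{η}`, `c` generates `𝔪𝒪_X`
  have hgenX : ∀ x : X, η ⤳ x →
      stalkIdeal (Scheme.IdealSheafData.ofIdealTop ((maximalIdeal S).map (Morphisms.algebraMapΓ π))) x =
        Ideal.span {ExcCount.toStalk π x c} := by
    intro x hx
    have hxv : σ.base x = v := by
      have h1 : σ.base η ⤳ σ.base x := hx.map σ.base.hom.continuous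
      have h2 : σ.base x ∈ closure ({σ.base η} : Set V) := specializes_iff_mem_closure.mp h1
      rw [hclosed.closure_eq] at h2
      exact h2
    have hcomp : ExcCount.toStalk π x c = (σ.stalkMap x).hom (ExcCount.toStalk b (σ.base x) c) := by
      rw [ExcCount.toStalk_eq_germ_comp_algebraMapΓ, ExcCount.toStalk_eq_germ_comp_algebraMapΓ]
      simp only [RingHom.coe_comp, Function.comp_apply]
      rw [Scheme.Hom.germ_stalkMap_apply σ ⊤ x trivial]
      change (X.presheaf.germ ⊤ x trivial).hom (π.appTop.hom _) =
        (X.presheaf.germ ⊤ x trivial).hom ((σ.app ⊤).hom (b.appTop.hom _))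
      rw [← hσ]
      rfl
    rw [← hKσ, stalkIdeal_comap_eq_map_stalkMap, hP (σ.base x) hxv, Ideal.map_span, Set.image_singleton,
      ← hcomp]
  -- hence `−Z + div(c)` avoids every point of `cl{η}`, and `(Z·E_η) = 0`
  have hs0 : baseToFunctionField π c ≠ 0 := by
    have hc0 : c ≠ 0 := by
      rintro rfl
      apply ht0
      have h := hgen
      rw [map_zero, Ideal.span_singleton_eq_bot.mpr rfl] at h
      exact Ideal.span_singleton_eq_bot.mp h.symm
    intro h0
    apply hc0
    have h1 : toFunctionField η (ExcCount.toStalk π η c) = 0 :=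
      (toFunctionField_germ_appTop π η c).trans h0
    have h2 : ExcCount.toStalk π η c = 0 :=
      (map_eq_zero_iff _ (toFunctionField_injective η)).mp h1
    exact ExcCount.toStalk_injective π η (h2.trans (map_zero _).symm)
  set D := CartierDivisor.ofIsEffectiveCartier _ hJ with hD
  have hav : ∀ y : X, η ⤳ y → (-D + CartierDivisor.principal _ hs0).Avoids y := fun y hy =>
    (CartierDivisor.avoids_add_principal_iff (-D) hs0).mpr
      (mem_nonvanishing_of_stalkIdeal_baseIdeal_eq_span π hJ (hgenX y hy))
  have h0 := ExcCount.excCurveDegree_eq_zero_of_forall_avoids π (-D + CartierDivisor.principal _ hs0) hav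
  rw [excCurveDegree_add π hη, excCurveDegree_principal π hη hs0, add_zero, excCurveDegree_neg π hη,
    neg_eq_zero] at h0
  exact h0

/-- **Some integral exceptional curve is NOT contracted by the domination** `σ : X → V` of a blowing up of `𝔪`
(`S` rational non-regular, `π = σ ≫ b` a desingularization): by du Val's negative definiteness some curve has
`(Z·E_{η′}) < 0` (tree `ExcCount.baseIdealDivisor_antinef_and_exists_neg_negDef`), and such a curve has `σ η′` non-closed
(`excCurveDegree_baseIdeal_eq_zero_of_isClosed_apply`).  This is the count drop of the localisation step: together with
`isClosed_singleton_apply_of_firstKind`, a first-kind curve `η` and this `η′` have `σ η ≠ σ η′`.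
[cite: Lipman1969, Lemma (14.1) (p. 224); Section 12, Remark 2 c) (p. 221)] -/
theorem exists_mem_excCurvePoints_not_isClosed_apply (hdim : ringKrullDim S = 2) (hrat : HasRationalSingularity S)
    (hsing : ¬ IsRegularLocalRing S) (hπ : IsResolution π) {V : Scheme.{0}} {b : V ⟶ Spec (.of S)}
    (hb : IsBlowup b (affineBlowup.idealSheaf (maximalIdeal S))) (σ : X ⟶ V) (hσ : σ ≫ b = π) :
    ∃ η' ∈ excCurvePoints π, ¬ IsClosed ({σ.base η'} : Set V) := by
  have hprin : ∀ x : X, IsLocalHom (ExcCount.toStalk π x) →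
      ((maximalIdeal S).map (ExcCount.toStalk π x)).IsPrincipal := fun x _ =>
    QuadraticTransform.isPrincipal_map_maximalIdeal_toStalk π hdim hrat hsing hπ x
  obtain ⟨hJ, -, η', hη', hlt⟩ := ExcCount.baseIdealDivisor_antinef_and_exists_neg_negDef hdim hπ
    (QuadraticTransform.maximalIdeal_ne_bot_of_ringKrullDim_eq_two hdim) (c := 1) (by rw [pow_one]) le_rfl hprin
  refine ⟨η', hη', fun hcl => ?_⟩
  have h0 := excCurveDegree_baseIdeal_eq_zero_of_isClosed_apply π hπ hb σ hσ hη' hcl hJ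
  rw [h0] at hlt
  exact lt_irrefl _ hlt

end Main

end Summit.ResolutionOfSingularities.ResolutionOfSingularities.Theorems.NoZeno.FirstKind

end
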